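import Literature.NumberTheory.EllipticCurves.HeegnerPointsKolyvaginPrimaryPairingProofs
import HarnessLib

/-!
# Route `PrintCFram`, crux C2 `BottomClassIndexLawFiveLe` (stmt-BirchSwinnertonDyer-20372), line
# `eisenstein-resource-bdp-line` (S2 `stub_kolyvaginUpper_borelCM_pairSum`, input (γ) at level `p^M`):
# **McCallum (2) / Gross Prop. 9.3 along a `𝔭`-adic tower** — a `π`-stable subgroup of
# `∏ᵢ ker π^{eᵢ}` with independent top-layer functionals is everything, for ANY additive `π` with
# `# ker π = p` (no Galois group, no simplicity, no commutant)
# (cell `bsd-print-cfram`, seat `bsd-line-cfram-p1-w2` g5; helper `--supports` 20372; 0 facts, 0 defs)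

HONEST FRAMING. Nothing about BSD is proved here, and nothing of S2 itself. The tree's level-`p^M`
form of Gross's Prop. 9.3 (`KolyvaginPairing.eq_piTors_of_stable_of_indep`, McCallum 1991 (2):
`Gal(L_C/L) ≅ Hom(C, E_{p^M}) = ∏ E_{p^M}[p^{eᵢ}]`) filters `E[p^M]` by the `p`-ADIC layers
`E[p] ⊂ E[p²] ⊂ …` and needs the bottom layer `E[p]` SIMPLE with scalar commutant. At the Borel
CM-ramified prime of the class the right filtration is the `𝔭`-ADIC one, `π = √−p ∈ End E`:
`ker π ⊂ ker π² = E[p] ⊂ ker π³ ⊂ …`, whose bottom layer `ker π = E[𝔭]` has prime order `p` — and a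
group of prime order is simple with scalar commutant under ANY action. So along the `𝔭`-adic tower
Gross's argument goes through WITHOUT any hypothesis on the Galois image, provided the subgroup is
`π`-stable (on the leaf: automatic from `Γ`-stability, since some `g ∈ Γ_{K''}` acts as `u + wπ`,
`p ∤ w` — `…BorelUniserialLeaf.exists_restrict_smul_eq_nonScalar`) and the TOP-LAYER functionals
`m ↦ ∑ cᵢ π^{eᵢ−1} mᵢ ∈ ker π` are independent:

* `eq_pi_ker_of_indep_le_one` (exponents `≤ 1`: a subgroup of `∏_{live} ker π` killed by no
  non-zero functional is everything — the tree's `eq_piTors_of_stable_of_indep_le_one` for the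
  prime-order group `ker π` with the trivial action of `ℤˣ`);
* **`eq_pi_ker_of_stable_of_indep_top`** (the tower): `T` abelian, `π : T →+ T` with `# ker π = p`
  prime, `ι` finite, `e : ι → ℕ`; a `π`-stable subgroup `J ≤ ∏ᵢ ker π^{eᵢ}` such that
  `∑ cᵢ π^{eᵢ−1}(mᵢ) = 0` on `J` forces `p ∣ cᵢ` for every live `i` (`eᵢ > 0`) is ALL of
  `∏ᵢ ker π^{eᵢ}`. Induction on `max eᵢ` exactly as in the tree (top layer by the case `≤ 1`,
  lower part `J ∩ ∏ ker π^{eᵢ−1}` by induction, its hypothesis fed by `m ↦ π ∘ m`).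

For `T = W(K̄'')[p^M]`, `π = √−p`: `ker π^{2k} = W[p^k]`, `ker π^{2k+1} = W[𝔭^{2k+1}]`, so this is
McCallum's (2) for `𝒪_𝔭`-modules of classes `C ≅ ⊕ 𝒪/𝔭^{fᵢ}` with `Hom_𝒪(C, W[p^M]) = ∏ W[𝔭^{fᵢ}]`;
the leaf discharge at level `p^M` (π-stability from `Γ_{K''}`-stability, machine currency) is the
next file. THEOREMS ONLY; no definition (the products are Mathlib's `AddSubgroup.pi`), no named
fact, no `sorry`. BSD is not proved by any of this; no summit statement is proved by this seat.
References: [McCallumLMS1991] §3 (2); [GrossLMS1991] Prop. 9.3; [Rubin1999] Prop. 5.4 (`E[𝔭ⁿ] ≅ 𝒪/𝔭ⁿ`).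
-/

set_option autoImplicit false
-- `…BirchSwinnertonDyer.BirchSwinnertonDyer.Theorems…` is the problem's mandated namespace (D-0017).
set_option linter.dupNamespace false

noncomputable section

open scoped Classical

namespace Summit.BirchSwinnertonDyer.BirchSwinnertonDyer.Theorems.PrintCFram.BorelKolyvaginPairing

open Literature.NumberTheory.EllipticCurves Literature.NumberTheory.EllipticCurves.KolyvaginPairing

section Tower

variable {T : Type*} [AddCommGroup T] (π : AddMonoid.End T) {p : ℕ}

/-- Unfolding `π^{n+1} x = π (πⁿ x)`. [folklore] -/
theorem pow_succ_apply (n : ℕ) (x : T) : (π ^ (n + 1)) x = π ((π ^ n) x) := by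
  rw [pow_succ', AddMonoid.End.coe_mul, Function.comp_apply]

/-- Unfolding `π^{n+1} x = πⁿ (π x)`. [folklore] -/
theorem pow_succ_apply' (n : ℕ) (x : T) : (π ^ (n + 1)) x = (π ^ n) (π x) := by
  rw [pow_succ, AddMonoid.End.coe_mul, Function.comp_apply]

/-- Membership in `∏ᵢ ker π^{eᵢ}` (Mathlib's `AddSubgroup.pi`). [folklore] -/
theorem mem_pi_ker_iff {ι : Type*} (e : ι → ℕ) (m : ι → T) :
    m ∈ AddSubgroup.pi Set.univ (fun i ↦ AddMonoidHom.ker (π ^ e i)) ↔ ∀ i, (π ^ e i) (m i) = 0 := by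
  simp only [AddSubgroup.mem_pi, Set.mem_univ, true_implies, AddMonoidHom.mem_ker]
  exact Iff.rfl

/-- A coordinate with exponent `0` vanishes on `∏ᵢ ker π^{eᵢ}`. [folklore] -/
theorem apply_eq_zero_of_mem_pi_ker {ι : Type*} {e : ι → ℕ} {m : ι → T}
    (hm : m ∈ AddSubgroup.pi Set.univ (fun i ↦ AddMonoidHom.ker (π ^ e i))) {i : ι} (hi : e i = 0) :
    m i = 0 := by
  have := (mem_pi_ker_iff π e m).mp hm i
  rwa [hi, pow_zero, AddMonoid.End.coe_one, id_eq] at this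

/-- **Every additive endomorphism of a group of prime order is an integer scalar** (it is cyclic).
[folklore] -/
theorem exists_eq_zsmul_of_card_eq_prime {A : Type*} [AddCommGroup A] (hp : p.Prime)
    (hA : Nat.card A = p) (f : A →+ A) : ∃ k : ℤ, ∀ t, f t = k • t := by
  haveI : Fact p.Prime := ⟨hp⟩
  haveI : IsAddCyclic A := isAddCyclic_of_prime_card hA
  obtain ⟨g, hg⟩ := IsAddCyclic.exists_generator (α := A)
  obtain ⟨k, hk⟩ := (AddSubgroup.mem_zmultiples_iff).mp (hg (f g))
  refine ⟨k, fun t => ?_⟩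
  obtain ⟨j, rfl⟩ := (AddSubgroup.mem_zmultiples_iff).mp (hg t)
  rw [map_zsmul, ← hk, smul_comm]

/-- **Exponents `≤ 1`.** `π : T →+ T` with `# ker π = p` prime; a subgroup `S ≤ ∏ᵢ ker π^{εᵢ}`,
all `εᵢ ≤ 1`, on which no functional `n ↦ ∑ cᵢ nᵢ` with some `p ∤ cᵢ` (`i` live) vanishes, is all of
`∏ᵢ ker π^{εᵢ}`: the tree's `eq_piTors_of_stable_of_indep_le_one` for the prime-order group `ker π`
(simple, scalar commutant) with the trivial action of `ℤˣ`. [cite: GrossLMS1991, Prop. 9.3 (proof)] -/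
theorem eq_pi_ker_of_indep_le_one (hp : p.Prime) (hker : Nat.card (AddMonoidHom.ker π) = p)
    {ι : Type*} [Fintype ι] {ε : ι → ℕ} (hε : ∀ i, ε i ≤ 1) (S : AddSubgroup (ι → T))
    (hle : S ≤ AddSubgroup.pi Set.univ (fun i ↦ AddMonoidHom.ker (π ^ ε i)))
    (hind : ∀ c : ι → ℤ, (∀ n ∈ S, ∑ i, c i • n i = 0) → ∀ i, 0 < ε i → (p : ℤ) ∣ c i) :
    S = AddSubgroup.pi Set.univ (fun i ↦ AddMonoidHom.ker (π ^ ε i)) := by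
  haveI : Fact p.Prime := ⟨hp⟩
  set K := AddMonoidHom.ker π with hK
  haveI : Fact (Nat.card K).Prime := ⟨by rw [hker]; exact hp⟩
  haveI : Finite K := Nat.finite_of_card_ne_zero (by rw [hker]; exact hp.ne_zero)
  -- every coordinate of an element of `∏ ker π^{εᵢ}`, `εᵢ ≤ 1`, lies in `ker π`
  have hcoord : ∀ n ∈ AddSubgroup.pi Set.univ (fun i ↦ AddMonoidHom.ker (π ^ ε i)), ∀ i, n i ∈ K := by
    intro n hn i
    rcases Nat.eq_zero_or_pos (ε i) with h0 | hpos
    · rw [apply_eq_zero_of_mem_pi_ker π hn h0]; exact K.zero_mem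
    · have h1 : ε i = 1 := le_antisymm (hε i) hpos
      have := (mem_pi_ker_iff π ε n).mp hn i
      rw [h1, pow_one] at this
      exact this
  -- transport to functions with values in the subtype `K`
  set Φ : (ι → K) →+ (ι → T) := K.subtype.compLeft ι with hΦ
  have hΦapp : ∀ s i, Φ s i = (s i : T) := fun _ _ ↦ rfl
  have hlift : ∀ n ∈ AddSubgroup.pi Set.univ (fun i ↦ AddMonoidHom.ker (π ^ ε i)), ∃ s, Φ s = n :=
    fun n hn ↦ ⟨fun i ↦ ⟨n i, hcoord n hn i⟩, funext fun i ↦ rfl⟩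
  have hpK : ∀ t : K, (p : ℤ) • t = 0 := fun t ↦ by
    have h := addOrderOf_dvd_natCard t
    rw [hker] at h
    have : (p : ℕ) • t = 0 := addOrderOf_dvd_iff_nsmul_eq_zero.mp h
    exact_mod_cast this
  set S' : AddSubgroup (ι → K) := S.comap Φ with hS'
  have htop : S' = piTors (T := K) p ε := by
    refine eq_piTors_of_stable_of_indep_le_one (G := ℤˣ) (T := K) (T₁ := K) hp
      (fun H _ ↦ H.eq_bot_or_eq_top_of_prime_card) (fun f _ ↦ exists_eq_zsmul_of_card_eq_prime hp hker f)
      (AddMonoidHom.id K) (fun _ _ ↦ rfl) (fun t _ ↦ ⟨t, rfl⟩) hε S' (fun g s hs ↦ ?_) (fun s _ i ↦ ?_)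
      (fun a ha i ↦ ?_)
    · -- `ℤˣ = {±1}` preserves every subgroup
      rcases Int.units_eq_one_or g with rfl | rfl
      · rw [one_smul]; exact hs
      · rw [Units.smul_def, Units.val_neg, Units.val_one, neg_one_zsmul]; exact S'.neg_mem hs
    · -- `S' ≤ ∏ K[p^{εᵢ}]`
      rcases Nat.eq_zero_or_pos (ε i) with h0 | hpos
      · rw [h0, pow_zero, one_smul]
        have hs' : Φ s ∈ S := by simpa [hS'] using ‹s ∈ S'›
        exact Subtype.ext (by rw [← hΦapp]; exact apply_eq_zero_of_mem_pi_ker π (hle hs') h0)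
      · rw [le_antisymm (hε i) hpos, pow_one]; exact hpK _
    · -- independence of the coordinate functionals on `S'`
      rcases Nat.eq_zero_or_pos (ε i) with h0 | hpos
      · rw [h0, pow_zero]; exact one_dvd _
      · rw [le_antisymm (hε i) hpos, pow_one]
        refine hind a (fun n hn ↦ ?_) i hpos
        obtain ⟨s, rfl⟩ := hlift n (hle hn)
        have h0 := ha s (by simpa [hS'] using hn)
        have : ∑ i, a i • Φ s i = ((∑ i, a i • s i : K) : T) := by
          rw [AddSubgroup.val_finsetSum]; exact Finset.sum_congr rfl fun i _ ↦ by rw [hΦapp]; rfl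
        rw [this, h0]; rfl
  refine le_antisymm hle fun n₀ hn₀ ↦ ?_
  obtain ⟨s₀, rfl⟩ := hlift n₀ hn₀
  have hs₀ : s₀ ∈ piTors (T := K) p ε := fun i ↦ by
    rcases Nat.eq_zero_or_pos (ε i) with h0 | hpos
    · rw [h0, pow_zero, one_smul]
      exact Subtype.ext (by rw [← hΦapp]; exact apply_eq_zero_of_mem_pi_ker π hn₀ h0)
    · rw [le_antisymm (hε i) hpos, pow_one]; exact hpK _
  rw [← htop] at hs₀
  simpa [hS'] using hs₀

/-- **McCallum 1991, (2) / Gross 1991, Prop. 9.3 along a `𝔭`-adic tower.** `T` abelian, `π : T →+ T`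
with `# ker π = p` prime, `ι` finite. A subgroup `J ≤ ∏ᵢ ker π^{eᵢ}` which is `π`-STABLE
(`m ∈ J ⟹ π ∘ m ∈ J`) and whose TOP-LAYER functionals are independent — `∑ cᵢ π^{eᵢ−1}(mᵢ) = 0` on
`J` forces `p ∣ cᵢ` for every `i` with `eᵢ > 0` — is all of `∏ᵢ ker π^{eᵢ}`. No group action,
simplicity or commutant is needed: the bottom layer `ker π` has prime order. (For `π = p·` this is the
tree's `eq_piTors_of_stable_of_indep` with its image hypotheses replaced by `# E[p] = p`, which never
holds; for `π = √−p` on a CM curve at a ramified `p` it is the statement the Borel port of S2 needs,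
`ker π^{2k} = E[p^k]`.) [cite: McCallumLMS1991, §3 (2)] [cite: GrossLMS1991, Prop. 9.3] -/
theorem eq_pi_ker_of_stable_of_indep_top (hp : p.Prime) (hker : Nat.card (AddMonoidHom.ker π) = p)
    {ι : Type*} [Fintype ι] (k : ℕ) :
    ∀ {e : ι → ℕ}, (∀ i, e i ≤ k) → ∀ (J : AddSubgroup (ι → T)),
      (∀ m ∈ J, (fun i ↦ π (m i)) ∈ J) →
      J ≤ AddSubgroup.pi Set.univ (fun i ↦ AddMonoidHom.ker (π ^ e i)) →
      (∀ c : ι → ℤ, (∀ m ∈ J, ∑ i, c i • (π ^ (e i - 1)) (m i) = 0) → ∀ i, 0 < e i → (p : ℤ) ∣ c i) →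
      J = AddSubgroup.pi Set.univ (fun i ↦ AddMonoidHom.ker (π ^ e i)) := by
  induction k with
  | zero =>
    intro e he J _ hle _
    refine le_antisymm hle fun m hm ↦ ?_
    have : m = 0 := funext fun i ↦ apply_eq_zero_of_mem_pi_ker π hm (Nat.le_zero.mp (he i))
    rw [this]; exact J.zero_mem
  | succ k ih =>
    intro e he J hπ hle hind
    -- the top layer `ψ m = (π^{eᵢ-1} mᵢ)ᵢ`
    set ψ : (ι → T) →+ (ι → T) :=
      { toFun := fun m i ↦ (π ^ (e i - 1)) (m i)
        map_zero' := funext fun i ↦ by simp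
        map_add' := fun m m' ↦ funext fun i ↦ by simp } with hψ
    have hψapp : ∀ m i, ψ m i = (π ^ (e i - 1)) (m i) := fun _ _ ↦ rfl
    set ε : ι → ℕ := fun i ↦ min (e i) 1 with hε
    have hψmem : ∀ m ∈ AddSubgroup.pi Set.univ (fun i ↦ AddMonoidHom.ker (π ^ e i)),
        ψ m ∈ AddSubgroup.pi Set.univ (fun i ↦ AddMonoidHom.ker (π ^ ε i)) := fun m hm ↦ by
      rw [mem_pi_ker_iff]
      intro i
      rw [hψapp]
      rcases Nat.eq_zero_or_pos (e i) with h0 | hpos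
      · rw [apply_eq_zero_of_mem_pi_ker π hm h0, map_zero, map_zero]
      · have h1 : min (e i) 1 = 1 := by omega
        simp only [hε]
        rw [h1, pow_one, ← pow_succ_apply, Nat.sub_add_cancel hpos]
        exact (mem_pi_ker_iff π e m).mp hm i
    have htop : J.map ψ = AddSubgroup.pi Set.univ (fun i ↦ AddMonoidHom.ker (π ^ ε i)) := by
      refine eq_pi_ker_of_indep_le_one π hp hker (fun i ↦ min_le_right _ _) (J.map ψ)
        (fun n hn ↦ ?_) (fun c hc i hi ↦ ?_)
      · obtain ⟨m, hm, rfl⟩ := hn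
        exact hψmem m (hle hm)
      · have hi' : 0 < e i := lt_of_lt_of_le hi (min_le_left _ _)
        exact hind c (fun m hm ↦ hc (ψ m) ⟨m, hm, rfl⟩) i hi'
    -- the lower part `J ∩ ∏ ker π^{eᵢ-1}` is full by induction
    set e' : ι → ℕ := fun i ↦ e i - 1 with he'
    have hbot : J ⊓ AddSubgroup.pi Set.univ (fun i ↦ AddMonoidHom.ker (π ^ e' i)) =
        AddSubgroup.pi Set.univ (fun i ↦ AddMonoidHom.ker (π ^ e' i)) := by
      refine ih (fun i ↦ by simp only [he']; have := he i; omega) _ (fun m hm ↦ ⟨hπ m hm.1, ?_⟩)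
        inf_le_right (fun c hc i hi ↦ ?_)
      · refine (mem_pi_ker_iff π e' _).mpr fun i ↦ ?_
        have := (mem_pi_ker_iff π e' m).mp hm.2 i
        rw [← pow_succ_apply', pow_succ_apply, this, map_zero]
      · -- feed `m ↦ π ∘ m` into the top-layer hypothesis of `J`
        have hi2 : 2 ≤ e i := by simp only [he'] at hi; omega
        set c' : ι → ℤ := fun j ↦ if 2 ≤ e j then c j else 0 with hc'
        have h := hind c' (fun m hm ↦ ?_) i (by omega)
        · simpa [hc', hi2] using h
        · have hπm : (fun j ↦ π (m j)) ∈ J ⊓ AddSubgroup.pi Set.univ (fun j ↦ AddMonoidHom.ker (π ^ e' j)) := by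
            refine ⟨hπ m hm, (mem_pi_ker_iff π e' _).mpr fun j ↦ ?_⟩
            rw [← pow_succ_apply']
            simp only [he']
            rcases Nat.eq_zero_or_pos (e j) with h0 | hpos
            · rw [apply_eq_zero_of_mem_pi_ker π (hle hm) h0, map_zero]
            · rw [Nat.sub_add_cancel hpos]; exact (mem_pi_ker_iff π e m).mp (hle hm) j
          have h0 := hc _ hπm
          rw [← h0]
          refine Finset.sum_congr rfl fun j _ ↦ ?_
          simp only [hc', he']
          by_cases hj : 2 ≤ e j
          · have hej : e j - 1 - 1 + 1 = e j - 1 := by omega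
            rw [if_pos hj, ← pow_succ_apply', hej]
          · rw [if_neg hj, zero_smul]
            have : e j - 1 - 1 = 0 := by omega
            rw [this, pow_zero, AddMonoid.End.coe_one, id_eq]
            rcases Nat.eq_zero_or_pos (e j) with h0 | hpos
            · rw [apply_eq_zero_of_mem_pi_ker π (hle hm) h0, map_zero, smul_zero]
            · have h1 : e j = 1 := by omega
              have := (mem_pi_ker_iff π e m).mp (hle hm) j
              rw [h1, pow_one] at this
              rw [this, smul_zero]
    -- conclusion
    refine le_antisymm hle fun m₀ hm₀ ↦ ?_
    have h1 : ψ m₀ ∈ J.map ψ := by rw [htop]; exact hψmem m₀ hm₀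
    obtain ⟨m, hm, hmm₀⟩ := h1
    have hd : m₀ - m ∈ AddSubgroup.pi Set.univ (fun i ↦ AddMonoidHom.ker (π ^ e' i)) := by
      rw [mem_pi_ker_iff]
      intro i
      have := congrFun hmm₀ i
      rw [hψapp, hψapp] at this
      simp only [he']
      rw [Pi.sub_apply, map_sub, this, sub_self]
    have hd' : m₀ - m ∈ J ⊓ AddSubgroup.pi Set.univ (fun i ↦ AddMonoidHom.ker (π ^ e' i)) := by
      rw [hbot]; exact hd
    have : m₀ = m + (m₀ - m) := by abel
    rw [this]
    exact J.add_mem hm hd'.1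

end Tower

end Summit.BirchSwinnertonDyer.BirchSwinnertonDyer.Theorems.PrintCFram.BorelKolyvaginPairing

end
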